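import Mathlib
import Summits.NavierStokesRegularity.NavierStokesRegularity.Theses.ComplexTouchdown
import Literature.Analysis.FluidPDE.NSCriticalClosureBesovKatoClass
import HarnessLib

/-!
# `ComplexTouchdown.SingularPointOfBlowup` — a blow-up has an `L^∞`-singular point (route
  `ComplexTouchdown`, item stmt-NavierStokesRegularity-1559, support; known assembly)

**Statement.** If a classical Leray–Hopf solution from a rapidly decaying datum on `[0,T)` has no
smooth extension past `T`, some `x₀` is an `L^∞`-singular point: `u` is unbounded on every backward
neighbourhood `{T − r < t < T} × B(x₀, r)`.

PROOF. Lemarié-Rieusset 2016, Thm. 15.1 (C) (tree: `exists_singularPoint_of_classical_of_not_hasSmoothExtensionPast`)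
gives `x₀` with `‖u‖_{L^∞(Q_ρ(T,x₀))} = ∞` for every small `ρ`; a bound `M` on the backward
neighbourhood of size `r` would bound `u` on `Q_ρ(T, x₀)` for `ρ ≤ min(r, 1)`, `ρ² < T`.

HONEST FRAMING: a statement about a HYPOTHETICAL blow-up; nothing here bears on the regularity
problem itself.
-/

noncomputable section

set_option linter.dupNamespace false

namespace Summit.NavierStokesRegularity.NavierStokesRegularity.Theorems

open MeasureTheory Set Function Metric
open scoped ENNReal
open Literature.Analysis Literature.Analysis.FluidPDE

/-- **Item stmt-NavierStokesRegularity-1559** (`ComplexTouchdown.SingularPointOfBlowup`): no smooth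
extension past `T` ⇒ an `L^∞`-singular point at time `T`. [this file; LemarieRieusset2016 Thm 15.1(C)] -/
theorem complexTouchdown_singularPointOfBlowup_proof :
    Summit.NavierStokesRegularity.NavierStokesRegularity.Theses.ComplexTouchdown.SingularPointOfBlowup := by
  unfold Summit.NavierStokesRegularity.NavierStokesRegularity.Theses.ComplexTouchdown.SingularPointOfBlowup
  intro ν T u p hν hT hsol hLH hdec hext
  obtain ⟨x₀, hx₀⟩ := exists_singularPoint_of_classical_of_not_hasSmoothExtensionPast hν hT hsol hLH hdec hext
  refine ⟨x₀, fun r hr M => ?_⟩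
  by_contra hno
  push Not at hno
  -- `hno : ∀ t ∈ Ico 0 T, T - r < t → ∀ x, dist x x₀ < r → ‖u t x‖ ≤ M`
  set ρ : ℝ := min (min r 1) (Real.sqrt T / 2) with hρ
  have hρpos : 0 < ρ := lt_min (lt_min hr one_pos) (by positivity)
  have hρr : ρ ≤ r := (min_le_left _ _).trans (min_le_left _ _)
  have hρ1 : ρ ≤ 1 := (min_le_left _ _).trans (min_le_right _ _)
  have hρT : ρ ^ 2 < T := by
    have h1 : ρ ≤ Real.sqrt T / 2 := min_le_right _ _
    have h2 : Real.sqrt T ^ 2 = T := Real.sq_sqrt hT.le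
    nlinarith [Real.sqrt_pos.2 hT]
  have hρsq : ρ ^ 2 ≤ r := by nlinarith
  have hle : eLpNorm (uncurry u) ∞ (volume.restrict (parabolicCylinder ρ ((T : ℝ), x₀))) ≤
      ENNReal.ofReal M := by
    rw [eLpNorm_exponent_top]
    refine eLpNormEssSup_le_of_ae_bound (ae_restrict_of_forall_mem
      (measurableSet_Ioo.prod measurableSet_ball) fun z hz => ?_)
    obtain ⟨ht, hx⟩ := hz
    have ht0 : 0 ≤ z.1 := by
      have : T - ρ ^ 2 < z.1 := ht.1
      linarith
    exact hno z.1 ⟨ht0, ht.2⟩ (by have : T - ρ ^ 2 < z.1 := ht.1; linarith) z.2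
      (lt_of_lt_of_le (mem_ball.1 hx) hρr)
  rw [hx₀ ρ hρpos hρT] at hle
  exact absurd hle (not_le.2 ENNReal.ofReal_lt_top)

end Summit.NavierStokesRegularity.NavierStokesRegularity.Theorems

end
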